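import Mathlib
import Literature.MathematicalPhysics.QuantumLattice.HubbardModel
import Literature.MathematicalPhysics.QuantumLattice.DWaveSource
import Literature.MathematicalPhysics.QuantumLattice.GroundStateSourceBounds
import Literature.MathematicalPhysics.QuantumLattice.KohnLuttinger

/-!
Sketch for crux-ideate stmt-HubbardSuperconductivity-1893 (CornerPersistence, route DeformationLadder;
the item was dropped from the route and closed `moot` at 2026-08-16T07:20Z, mid-session), ideator 1,
round 1. First lemmas of the two idea cards; statements only (elaboration check) except the Topkis
lemma, which is proved. Imports only Literature modules (no route file), so it stays coherent.
-/

noncomputable section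

namespace Summit.HubbardSuperconductivity.HubbardSuperconductivity.Cruxes.CornerPersistence.SketchIdeator1

open Literature.MathematicalPhysics.QuantumLattice Filter Set
open scoped Matrix

set_option linter.dupNamespace false

/-! ## Card `quasi-average-corner` -/

/-- Transfer target C⁺ (GC window quasi-average): at some `U > 0` there is a window of chemical
potentials on which the Koma–Tasaki `d`-wave source density is bounded below by `m > 0`
UNIFORMLY in the source `h ∈ (0, h₀]`, eventually in `L` (thermodynamic limit first), and the
window's ground-state densities bracket `1 - δ`. -/
def WindowQuasiAverage : Prop :=
  ∃ U : ℝ, 0 < U ∧ ∃ δ ∈ Set.Ioo (0:ℝ) (1 / 2), ∃ μ₁ μ₂ : ℝ, μ₁ < μ₂ ∧ ∃ m : ℝ, 0 < m ∧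
    ∃ h₀ : ℝ, 0 < h₀ ∧
      (∀ μ ∈ Set.Icc μ₁ μ₂, ∀ h ∈ Set.Ioc (0:ℝ) h₀,
        ∀ᶠ L : ℕ in atTop, m ≤ dWaveSourceDensity (L + 1) U μ h) ∧
      (∀ᶠ L : ℕ in atTop,
        ((hubbardTorusWith 2 (L + 1) 1 U μ₁).groundStateFunctional totalNumber).re
            / ((L + 1 : ℕ) : ℝ) ^ 2 ≤ 1 - δ ∧
          1 - δ ≤ ((hubbardTorusWith 2 (L + 1) 1 U μ₂).groundStateFunctional totalNumber).re
            / ((L + 1 : ℕ) : ℝ) ^ 2)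

/-- FIRST LEMMA (card `quasi-average-corner`): the ENVELOPE/CHORD inequality behind
"quasi-average ⇒ corner". For a real function `e` (the sourced energy density `h ↦ ẽ_U(h)`)
satisfying the tangent bound at `0` with slope `-2m` (H1), the matching local lower tangent with
slope `-2M`, `M² < 2m²` (H2, from `m(h) → m₊` as `h → 0⁺`), and a global Lipschitz lower bound
(H3, from `‖pF + pFᴴ‖ ≤ C L²`), the approximating-Hamiltonian values
`F(g) = ⨅_{h ≥ 0} [e h + h²/g]` have chords `F(g/2) - F(g) ≥ g (m² - M²/2)` for all small `g`;
with ApproximatingHamiltonianGC (stmt-1895) and the finite-`L` chord inequality this is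
every-ground-state `d`-wave LRO `≥ 2(m² - M²/2)` of `K(U,g)`, uniformly in `g ∈ (0, 2h₁/C]`. -/
def EnvelopeChord : Prop :=
  ∀ (e : ℝ → ℝ) (m M C h₁ g : ℝ), 0 < m → 0 ≤ M → 0 < C → 0 < h₁ → 0 < g → g ≤ 2 * h₁ / C →
    (∀ h : ℝ, 0 ≤ h → e h ≤ e 0 - 2 * m * h) →
    (∀ h ∈ Set.Icc (0:ℝ) h₁, e 0 - 2 * M * h ≤ e h) →
    (∀ h : ℝ, 0 ≤ h → e 0 - C * h ≤ e h) →
      g * (m ^ 2 - M ^ 2 / 2) ≤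
        (⨅ h : {h : ℝ // 0 ≤ h}, (e h + (h : ℝ) ^ 2 / (g / 2))) -
          (⨅ h : {h : ℝ // 0 ≤ h}, (e h + (h : ℝ) ^ 2 / g))

/-- Finite-`L` input already in the tree (used, not re-proved): the source (Griffiths /
Hellmann–Feynman) inequality for the tracial ground state of `dWaveSourceTorus`. -/
example (L : ℕ) [NeZero L] (U μ h h' : ℝ)
    (hH : (hubbardTorusWith 2 L 1 U μ).IsHermitian) :
    (h' - h) * ((dWaveSourceTorus L U μ h).groundStateFunctional
        (pairField dWaveFormFactor L + (pairField dWaveFormFactor L)ᴴ)).re ≤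
      Matrix.groundEnergy (dWaveSourceTorus L U μ h) -
        Matrix.groundEnergy (dWaveSourceTorus L U μ h') := by
  have := sub_mul_re_groundStateFunctional_le (n := Finset (Orb (FermionTorus 2 L)))
    (K := hubbardTorusWith 2 L 1 U μ)
    (O := pairField dWaveFormFactor L + (pairField dWaveFormFactor L)ᴴ) hH
    (isHermitian_pairField_add_conjTranspose L) h h'
  simpa [dWaveSourceTorus] using this

/-! ## Card `gap-bootstrap-in-g` -/

/-- FIRST LEMMA (card `gap-bootstrap-in-g`), the a-priori mechanism in its solvable shadow
(Topkis monotone comparative statics for the approximating-Hamiltonian variational problem):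
if `h` minimises `e x + x²/g` over `x ≥ 0` and `h'` minimises `e x + x²/g'` with `g ≤ g'`, and
`h' < h`, then `h` ALSO minimises at `g'` — the largest self-consistent source (gap) is
non-decreasing in the total reduced `B₁g` coupling. This is what makes the bootstrap set closed:
the output gap at parameter `g` dominates the gap of the intrinsic coupling alone. -/
def LargestMinimiserMonotone : Prop :=
  ∀ (e : ℝ → ℝ) (g g' h h' : ℝ), 0 < g → g ≤ g' → 0 ≤ h → 0 ≤ h' → h' < h →
    IsMinOn (fun x : ℝ => e x + x ^ 2 / g) (Set.Ici 0) h →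
    IsMinOn (fun x : ℝ => e x + x ^ 2 / g') (Set.Ici 0) h' →
      IsMinOn (fun x : ℝ => e x + x ^ 2 / g') (Set.Ici 0) h

/-- The continuity-method driver (pure topology of the half-open interval): a subset of
`(0, g₁]` containing the anchor `g₁`, relatively closed, and "open to the left with slack" is all
of `(0, g₁]`. In the line, `S = {g : the anchored expansion converges at g with gap ≥ Δ_min}`. -/
def BootstrapDriver : Prop :=
  ∀ (g₁ : ℝ) (S : Set ℝ), 0 < g₁ → g₁ ∈ S → S ⊆ Set.Ioc 0 g₁ →
    (∀ x ∈ Set.Ioc 0 g₁, x ∈ closure S → x ∈ S) →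
    (∀ g ∈ S, ∃ ε > 0, Set.Ioc (g - ε) g ∩ Set.Ioi 0 ⊆ S) →
      S = Set.Ioc 0 g₁


/-- Typed model-specific INPUT of card `gap-bootstrap-in-g` (certified-computation class, companion
of WeakCouplingBCS support `WcbcsKohnLuttingerB1g` = stmt-0158, which gives the MARGIN over the
other `D₄` channels): the second-order `B₁g` channel bottom is strictly ATTRACTIVE, with a
coefficient `α > 0`, on a doping interval — the sign that the a-priori gap bound consumes
(`Δ(g) ≥ W·exp(−1/(ρ_d α U²(1−CU)))` for every `g ≥ 0`). The bare `U` projects to zero in `B₁g`,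
so `channelInf … B1g = U²·inf_{B₁g} ⟨ψ, χ(k+k') ψ⟩` and the claim is `inf_{B₁g} ⟨ψ, χ ψ⟩ ≤ −α`. -/
def B1gAttractive : Prop :=
  ∃ a b α U₁ : ℝ, 0 < a ∧ a < b ∧ b < 1 / 2 ∧ 0 < α ∧ 0 < U₁ ∧ ∀ δ ∈ Set.Icc a b,
    ∀ U ∈ Set.Ioo (0:ℝ) U₁,
      channelInf (squareDispersion 1 0) (chemicalPotentialOfDensity (squareDispersion 1 0) (1 - δ))
          U D4Irrep.B1g ≤ -(α * U ^ 2)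

/-- The bootstrap's OUTPUT in the route's own currency (GC thermodynamic form of the corner,
uniform in `g`, at fixed `U`): the approximating-Hamiltonian value function has chords bounded
below linearly — hence (ApproximatingHamiltonianGC + canonical Legendre + finite-`L` chord
inequality, all DeformationLadder supports) CornerPersistence. Stated over the limit energies
`e` of stmt-1895 to stay inside existing declarations. -/
def UniformCornerSlope : Prop :=
  ∃ U : ℝ, 0 < U ∧ ∃ μ₁ μ₂ : ℝ, μ₁ < μ₂ ∧ ∃ a : ℝ, 0 < a ∧ ∃ g₁ : ℝ, 0 < g₁ ∧
    ∀ μ ∈ Set.Icc μ₁ μ₂, ∀ e : ℝ → ℝ,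
      (∀ h : ℝ, 0 ≤ h → Filter.Tendsto (fun L : ℕ =>
          Matrix.groundEnergy (dWaveSourceTorus (L + 1) U μ h) / ((L + 1 : ℕ) : ℝ) ^ 2)
          Filter.atTop (nhds (e h))) →
      ∀ g ∈ Set.Ioc (0:ℝ) g₁,
        g * a ≤ (⨅ h : {h : ℝ // 0 ≤ h}, (e h + (h : ℝ) ^ 2 / (g / 2))) -
          (⨅ h : {h : ℝ // 0 ≤ h}, (e h + (h : ℝ) ^ 2 / g))

/-- Proof of the Topkis lemma (it is two lines). -/
theorem largestMinimiserMonotone : LargestMinimiserMonotone := by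
  intro e g g' h h' hg hgg' hh hh' hlt hmin hmin' x hx
  have h1 : e h + h ^ 2 / g ≤ e h' + h' ^ 2 / g := hmin (Set.mem_Ici.2 hh')
  have h2 : e h' + h' ^ 2 / g' ≤ e x + x ^ 2 / g' := hmin' hx
  have hg' : 0 < g' := lt_of_lt_of_le hg hgg'
  have hsq : h' ^ 2 ≤ h ^ 2 := by nlinarith
  -- (h² - h'²)(1/g' - 1/g) ≤ 0
  have key : h ^ 2 / g' - h' ^ 2 / g' ≤ h ^ 2 / g - h' ^ 2 / g := by
    rw [← sub_div, ← sub_div]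
    exact div_le_div_of_nonneg_left (by nlinarith) hg hgg'
  show e h + h ^ 2 / g' ≤ e x + x ^ 2 / g'
  linarith

end Summit.HubbardSuperconductivity.HubbardSuperconductivity.Cruxes.CornerPersistence.SketchIdeator1
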